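import Summits.NavierStokesRegularity.NavierStokesRegularity.Theorems.ExtremiserTransienceTwoThirdsTranslateAverage
import Summits.NavierStokesRegularity.NavierStokesRegularity.Theorems.ExtremiserTransienceTwoThirdsCellLattice
import Literature.Analysis.FluidPDE.VectorCalculus
import HarnessLib

/-!
# Route `ExtremiserTransience`, crux `NearExtremalTransiencePerFlow` (stmt-NavierStokesRegularity-26567),
# LINE g10-1 «two_thirds» (ns-idea-10), stub S1a′ — BRICK 4d: the BRIDGE from lattice-averaged bad weight to the thick uncovered enstrophy

`--supports stmt-NavierStokesRegularity-26567` (helper; prover seat ns-net-p2 g12).  Glues brick 4a (`…TwoThirdsTranslateAverage`, p724270) and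
brick 4c (`…TwoThirdsCellLattice`, p725193) into the exact hypothesis shape of brick 4b (`…TwoThirdsAssembly.typicalSelection_of_uncovered_small`,
p724691): for the THICK-RESTRICTED ENSTROPHY MEASURE `μ_Θ = ‖curl v‖²·1_Θ dx`, a measurable set `G` of good centres, the cell radius `s` (inner
radius `s/2`, lattice spacing `4s`) and the cubic cell basis `b` of brick 4c,

  `∫_{Θ ∩ U} ‖curl v‖² ≤ 4096 · β`   whenever   `∫_{τ ∈ Q_b} (Σ_{g ∈ Λ_b} 1_{Gᶜ}(g+τ) μ_Θ(B(g+τ, s/2))) dτ ≤ β · vol(Q_b)`,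

`U = {y : no c ∈ G with dist c y < s/2}` (`volume_ball_mul_measure_uncovered_le` + `lintegral_eq_setLIntegral_tsum_lattice` + `volume_cellCube_le`;
the hypothesis is the τ-INTEGRATED form, so exceptional translates are allowed).  Also: `thickMeasure_apply` (`μ_Θ A = ofReal ∫_{Θ∩A} ‖curl v‖²`),
`thickMeasure_ball_le` (`μ_Θ(B(c,ρ)) ≤ ofReal Z_{B(c,ρ')}` for `ρ ≤ ρ'`), the currency brick 2 will produce its per-translate bounds in.
HONEST FRAMING: measure-theoretic bookkeeping; nothing about Navier–Stokes is proved; no summit is proved by a line. [folklore]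
-/

noncomputable section

open scoped Topology ENNReal NNReal
open MeasureTheory Filter Set Metric Function
open Literature.Analysis.FluidPDE

namespace Summit.NavierStokesRegularity.NavierStokesRegularity.Theorems.NearExtremalTransiencePerFlow.TwoThirds

-- the problem directory repeats the summit name (`NavierStokesRegularity/NavierStokesRegularity`)
set_option linter.dupNamespace false
set_option linter.style.longLine false

/-- The thick-restricted enstrophy measure applied to a measurable set: `μ_Θ A = ofReal (∫_{Θ ∩ A} ‖curl v‖²)`. -/
theorem thickMeasure_apply {v : EuclideanSpace ℝ (Fin 3) → EuclideanSpace ℝ (Fin 3)} (hint : Integrable (fun x => ‖curl v x‖ ^ 2))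
    {Θ A : Set (EuclideanSpace ℝ (Fin 3))} (hA : MeasurableSet A) :
    ((volume.restrict Θ).withDensity (fun x => ENNReal.ofReal (‖curl v x‖ ^ 2))) A = ENNReal.ofReal (∫ x in Θ ∩ A, ‖curl v x‖ ^ 2) := by
  rw [withDensity_apply _ hA, Measure.restrict_restrict hA, Set.inter_comm,
    ofReal_integral_eq_lintegral_ofReal (hint.integrableOn) (Eventually.of_forall fun x => sq_nonneg _)]

/-- Inner balls are paid by enstrophy: `μ_Θ(B(c, ρ)) ≤ ofReal (∫_{B(c, ρ')} ‖curl v‖²)` for `ρ ≤ ρ'`. -/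
theorem thickMeasure_ball_le {v : EuclideanSpace ℝ (Fin 3) → EuclideanSpace ℝ (Fin 3)} (hint : Integrable (fun x => ‖curl v x‖ ^ 2))
    {Θ : Set (EuclideanSpace ℝ (Fin 3))} (c : EuclideanSpace ℝ (Fin 3)) {ρ ρ' : ℝ} (hρ : ρ ≤ ρ') :
    ((volume.restrict Θ).withDensity (fun x => ENNReal.ofReal (‖curl v x‖ ^ 2))) (Metric.ball c ρ) ≤
      ENNReal.ofReal (∫ x in Metric.ball c ρ', ‖curl v x‖ ^ 2) := by
  rw [thickMeasure_apply hint measurableSet_ball]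
  refine ENNReal.ofReal_le_ofReal ?_
  exact setIntegral_mono_set hint.integrableOn (Eventually.of_forall fun x => sq_nonneg _)
    (Eventually.of_forall fun x hx => Metric.ball_subset_ball hρ hx.2)

/-- **Uncovered measure from the lattice-averaged bad inner weight** (any s-finite measure `μ`): with the cubic cell basis `b` of spacing `4s`,
`μ{y : ∀ c, dist c y < s/2 → c ∉ G} ≤ ofReal(4096·β)` whenever `∫_{τ ∈ Q_b} Σ_{g} 1_{Gᶜ}(g+τ) μ(B(g+τ, s/2)) dτ ≤ ofReal β · vol(Q_b)`. [folklore] -/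
theorem measure_uncovered_le_of_lattice_average (μ : Measure (EuclideanSpace ℝ (Fin 3))) [SFinite μ]
    {G : Set (EuclideanSpace ℝ (Fin 3))} (hG : MeasurableSet G) {s : ℝ} (hs : 0 < s)
    (b : Module.Basis (Fin 3) ℝ (EuclideanSpace ℝ (Fin 3)))
    (hbQ : ∀ x : EuclideanSpace ℝ (Fin 3), x ∈ ZSpan.fundamentalDomain b ↔ ∀ j, x j ∈ Set.Ico 0 (4 * s))
    {β : ℝ}
    (hbad : ∫⁻ τ in ZSpan.fundamentalDomain b, ∑' g : (Submodule.span ℤ (Set.range b)).toAddSubgroup,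
        Gᶜ.indicator (fun c => μ (Metric.ball c (s / 2))) ((g : EuclideanSpace ℝ (Fin 3)) + τ) ≤
          ENNReal.ofReal β * volume (ZSpan.fundamentalDomain b)) :
    μ {y | ∀ c, dist c y < s / 2 → c ∉ G} ≤ ENNReal.ofReal (4096 * β) := by
  -- measurability of the bad-weight density `c ↦ 1_{Gᶜ}(c) μ(B(c, s/2))`
  have hmeas : Measurable fun c : EuclideanSpace ℝ (Fin 3) => Gᶜ.indicator (fun c => μ (Metric.ball c (s / 2))) c := by
    have hball : Measurable fun c : EuclideanSpace ℝ (Fin 3) => μ (Metric.ball c (s / 2)) := by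
      have hS : MeasurableSet {p : EuclideanSpace ℝ (Fin 3) × EuclideanSpace ℝ (Fin 3) | dist p.2 p.1 < s / 2} :=
        measurableSet_lt (continuous_snd.dist continuous_fst).measurable measurable_const
      exact measurable_measure_prodMk_left (ν := μ) hS
    exact hball.indicator hG.compl
  -- the cube and its volume
  have hQeq : ZSpan.fundamentalDomain b = {x : EuclideanSpace ℝ (Fin 3) | ∀ j, x j ∈ Set.Ico 0 (4 * s)} := by
    ext x; exact hbQ x
  have hQvol : volume (ZSpan.fundamentalDomain b) ≤ 4096 * volume (Metric.ball (0 : EuclideanSpace ℝ (Fin 3)) (s / 2)) := by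
    rw [hQeq]; exact volume_cellCube_le hs
  have h1 : volume (Metric.ball (0 : EuclideanSpace ℝ (Fin 3)) (s / 2)) * μ {y | ∀ c, dist c y < s / 2 → c ∉ G} ≤
      ENNReal.ofReal β * (4096 * volume (Metric.ball (0 : EuclideanSpace ℝ (Fin 3)) (s / 2))) := by
    calc volume (Metric.ball (0 : EuclideanSpace ℝ (Fin 3)) (s / 2)) * μ {y | ∀ c, dist c y < s / 2 → c ∉ G}
        ≤ ∫⁻ c, Gᶜ.indicator (fun c => μ (Metric.ball c (s / 2))) c := volume_ball_mul_measure_uncovered_le μ hG (s / 2)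
      _ = ∫⁻ τ in ZSpan.fundamentalDomain b, ∑' g : (Submodule.span ℤ (Set.range b)).toAddSubgroup,
            Gᶜ.indicator (fun c => μ (Metric.ball c (s / 2))) ((g : EuclideanSpace ℝ (Fin 3)) + τ) :=
          lintegral_eq_setLIntegral_tsum_lattice b hmeas
      _ ≤ ENNReal.ofReal β * volume (ZSpan.fundamentalDomain b) := hbad
      _ ≤ ENNReal.ofReal β * (4096 * volume (Metric.ball (0 : EuclideanSpace ℝ (Fin 3)) (s / 2))) := by gcongr
  have hvpos : volume (Metric.ball (0 : EuclideanSpace ℝ (Fin 3)) (s / 2)) ≠ 0 := (measure_ball_pos volume 0 (by positivity)).ne'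
  have hvtop : volume (Metric.ball (0 : EuclideanSpace ℝ (Fin 3)) (s / 2)) ≠ ⊤ := measure_ball_lt_top.ne
  have h1' : volume (Metric.ball (0 : EuclideanSpace ℝ (Fin 3)) (s / 2)) * μ {y | ∀ c, dist c y < s / 2 → c ∉ G} ≤
      volume (Metric.ball (0 : EuclideanSpace ℝ (Fin 3)) (s / 2)) * (ENNReal.ofReal β * 4096) := by
    calc _ ≤ ENNReal.ofReal β * (4096 * volume (Metric.ball (0 : EuclideanSpace ℝ (Fin 3)) (s / 2))) := h1
      _ = volume (Metric.ball (0 : EuclideanSpace ℝ (Fin 3)) (s / 2)) * (ENNReal.ofReal β * 4096) := by ring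
  have h2 := (ENNReal.mul_le_mul_iff_right hvpos hvtop).1 h1'
  rw [show ENNReal.ofReal β * 4096 = ENNReal.ofReal (4096 * β) by
    rw [mul_comm, ENNReal.ofReal_mul (by norm_num), ENNReal.ofReal_ofNat]] at h2
  exact h2

/-- **Brick 4d — the bridge.**  For the thick-restricted enstrophy measure `μ_Θ = ‖curl v‖²·1_Θ dx`, a measurable set `G` of good centres, inner
radius `s/2` and the cubic cell basis `b` (brick 4c): if the τ-integrated bad inner weight is `≤ ofReal β · vol(Q_b)`, then
`∫_{Θ ∩ U} ‖curl v‖² ≤ 4096·β` for the uncovered set `U = {y : ∀ c, dist c y < s/2 → c ∉ G}` — the hypothesis shape of brick 4b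
`typicalSelection_of_uncovered_small`. [folklore] -/
theorem thickUncovered_le_of_lattice_average {v : EuclideanSpace ℝ (Fin 3) → EuclideanSpace ℝ (Fin 3)}
    (hint : Integrable (fun x => ‖curl v x‖ ^ 2)) {Θ : Set (EuclideanSpace ℝ (Fin 3))}
    {G : Set (EuclideanSpace ℝ (Fin 3))} (hG : MeasurableSet G) {s : ℝ} (hs : 0 < s)
    (b : Module.Basis (Fin 3) ℝ (EuclideanSpace ℝ (Fin 3)))
    (hbQ : ∀ x : EuclideanSpace ℝ (Fin 3), x ∈ ZSpan.fundamentalDomain b ↔ ∀ j, x j ∈ Set.Ico 0 (4 * s))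
    {β : ℝ} (hβ : 0 ≤ β)
    (hbad : ∫⁻ τ in ZSpan.fundamentalDomain b, ∑' g : (Submodule.span ℤ (Set.range b)).toAddSubgroup,
        Gᶜ.indicator (fun c => ((volume.restrict Θ).withDensity (fun x => ENNReal.ofReal (‖curl v x‖ ^ 2))) (Metric.ball c (s / 2)))
          ((g : EuclideanSpace ℝ (Fin 3)) + τ) ≤ ENNReal.ofReal β * volume (ZSpan.fundamentalDomain b)) :
    ∫ x in Θ ∩ {y | ∀ c, dist c y < s / 2 → c ∉ G}, ‖curl v x‖ ^ 2 ≤ 4096 * β := by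
  have hUm : MeasurableSet {y : EuclideanSpace ℝ (Fin 3) | ∀ c, dist c y < s / 2 → c ∉ G} :=
    (isClosed_uncovered G (s / 2)).measurableSet
  have h := measure_uncovered_le_of_lattice_average
    ((volume.restrict Θ).withDensity (fun x => ENNReal.ofReal (‖curl v x‖ ^ 2))) hG hs b hbQ hbad
  rw [thickMeasure_apply hint hUm] at h
  exact (ENNReal.ofReal_le_ofReal_iff (by positivity)).1 h

end Summit.NavierStokesRegularity.NavierStokesRegularity.Theorems.NearExtremalTransiencePerFlow.TwoThirds

end
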